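import Literature.NumberTheory.LFunctions.KloostermanFractionsOffDiagT
import Literature.NumberTheory.LFunctions.KloostermanFractionsOffDiagMu
import HarnessLib

/-!
# Bilinear forms with Kloosterman fractions: the bound for the off-diagonal `𝒪_b`

Bettin–Chandee, *Trilinear forms with Kloosterman fractions* (arXiv:1502.00769), §4.2–4.3, in
the simplified setting of this series (`A = 1`, prime `ℓ₂` outside Cauchy–Schwarz, degenerate
tuples bounded trivially).  With `𝓜 = (M₁, M₂] ∩ {(m,b)=1}`,

  `𝒪 = Σ_{m ∈ 𝓜} kfOff(m) = (degenerate) + Σ_{μ ≤ 2N'} 𝒮(bμ, N'/μ, γ_μ, 𝓛_μ)`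

(`kfm_offdiag_split`); the degenerate part is `kfo_deg_bound`, the sum `𝒮(bμ, …)` is bounded by
`kft_S_le` with `D_μ = ⌈4L(N'/μ)/(M₁+1)⌉` when `4L N'/μ ≥ M₁ + 1` and trivially (`kfm_S_triv`)
otherwise, uniformly in `μ`, and `Σ_μ ‖γ_μ‖² ≤ T' ‖γ‖²` (`kfm_sum_norm_sq_mu`).

Main results: `kfO_mu_le` (one `μ`), `kfO_le` (the off-diagonal).

## References
* S. Bettin, V. Chandee, *Trilinear forms with Kloosterman fractions*, Adv. Math. 328 (2018),
  arXiv:1502.00769, §4.2–4.3, (ees), (rtyu). [cite: BettinChandee2018, §4.3]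
* W. Duke, J. Friedlander, H. Iwaniec, *Bilinear forms with Kloosterman fractions*,
  Invent. Math. 128 (1997) 23–43, §4. [cite: DukeFriedlanderIwaniec1997, §4]
-/

noncomputable section

open Finset

namespace Literature.NumberTheory.LFunctions

/-! ### One `μ` -/

/-- The real-variable inequality behind the uniformity in `μ` of the Weil regime:
with `ℓc ≤ L`, `fl ≤ 2N'/μ`, `Dμ ≤ 8LN'/(μ M⁺)`, `τ ≤ T'`, `Fμ ≤ Fs`, `Cμ ≤ Cs`, `N'' = N'/μ`,
`ℓc (fl ℓc 2Dμ Dg + 24 τ L² Dμ² 4T'N''FμCμ) ≤ L(32L²N'²Dg/M⁺ + 6144T'²L⁴N'³FsCs/M⁺²)/μ²`.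
[folklore] -/
theorem kfO_alg {L N' μ Mp T' Dg Fs Cs ℓc fl Dμ τ Fμ Cμ N'' : ℝ} (hL : 0 < L) (hN' : 0 < N')
    (hμ : 1 ≤ μ) (hMp : 0 < Mp) (hT' : 0 ≤ T') (hDg : 0 ≤ Dg) (hFs : 0 ≤ Fs) (hCμ0 : 0 ≤ Cμ)
    (hℓc0 : 0 ≤ ℓc) (hfl0 : 0 ≤ fl) (hDμ0 : 0 ≤ Dμ) (hτ0 : 0 ≤ τ) (hFμ0 : 0 ≤ Fμ)
    (hN''0 : 0 ≤ N'') (hℓc : ℓc ≤ L) (hfl : fl ≤ 2 * N' / μ)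
    (hDm : Dμ ≤ 8 * L * N' / (μ * Mp)) (hτ : τ ≤ T') (hF : Fμ ≤ Fs) (hC : Cμ ≤ Cs)
    (hN'' : N'' = N' / μ) :
    ℓc * (fl * (ℓc * (2 * Dμ)) * Dg + 24 * τ * L ^ 2 * Dμ ^ 2 * (4 * T' * N'' * Fμ * Cμ)) ≤
      L * (32 * L ^ 2 * N' ^ 2 * Dg / Mp + 6144 * T' ^ 2 * L ^ 4 * N' ^ 3 * Fs * Cs / Mp ^ 2) /
        μ ^ 2 := by
  have hμ0 : 0 < μ := by linarith
  set Dm : ℝ := 8 * L * N' / (μ * Mp) with hDm_def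
  have hDm0 : 0 ≤ Dm := by rw [hDm_def]; positivity
  have hCs0 : 0 ≤ Cs := hCμ0.trans hC
  have ht1 : fl * (ℓc * (2 * Dμ)) * Dg ≤ (2 * N' / μ) * (L * (2 * Dm)) * Dg :=
    mul_le_mul_of_nonneg_right (mul_le_mul hfl (mul_le_mul hℓc (by linarith)
      (by positivity) hL.le) (by positivity) (by positivity)) hDg
  have ht2 : 24 * τ * L ^ 2 * Dμ ^ 2 * (4 * T' * N'' * Fμ * Cμ) ≤
      24 * T' * L ^ 2 * Dm ^ 2 * (4 * T' * N'' * Fs * Cs) := by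
    have hDμ2 : Dμ ^ 2 ≤ Dm ^ 2 := pow_le_pow_left₀ hDμ0 hDm 2
    have ha : 24 * τ * L ^ 2 * Dμ ^ 2 ≤ 24 * T' * L ^ 2 * Dm ^ 2 :=
      mul_le_mul (mul_le_mul_of_nonneg_right (mul_le_mul_of_nonneg_left hτ (by norm_num))
        (sq_nonneg _)) hDμ2 (sq_nonneg _) (by positivity)
    have hin : 4 * T' * N'' * Fμ * Cμ ≤ 4 * T' * N'' * Fs * Cs :=
      mul_le_mul (mul_le_mul_of_nonneg_left hF (by positivity)) hC hCμ0 (by positivity)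
    exact mul_le_mul ha hin (by positivity) (by positivity)
  calc _ ≤ L * ((2 * N' / μ) * (L * (2 * Dm)) * Dg +
        24 * T' * L ^ 2 * Dm ^ 2 * (4 * T' * N'' * Fs * Cs)) :=
        mul_le_mul hℓc (add_le_add ht1 ht2) (by positivity) hL.le
    _ = L * (32 * L ^ 2 * N' ^ 2 * Dg / (μ ^ 2 * Mp) +
        6144 * T' ^ 2 * L ^ 4 * N' ^ 3 * Fs * Cs / (μ ^ 3 * Mp ^ 2)) := by
        rw [hDm_def, hN'']
        field_simp
        ring
    _ ≤ L * (32 * L ^ 2 * N' ^ 2 * Dg / (μ ^ 2 * Mp) +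
        6144 * T' ^ 2 * L ^ 4 * N' ^ 3 * Fs * Cs / (μ ^ 2 * Mp ^ 2)) := by
        refine mul_le_mul_of_nonneg_left (add_le_add le_rfl ?_) hL.le
        refine div_le_div_of_nonneg_left (by positivity) (by positivity) ?_
        refine mul_le_mul_of_nonneg_right ?_ (by positivity)
        calc μ ^ 2 = μ ^ 2 * 1 := (mul_one _).symm
          _ ≤ μ ^ 2 * μ := mul_le_mul_of_nonneg_left hμ (by positivity)
          _ = μ ^ 3 := by ring
    _ = _ := by field_simp

set_option maxHeartbeats 1600000 in
/-- **The sum `𝒮(bμ, N'/μ, γ_μ, 𝓛_μ)` for one `μ ≤ 2N'`** (B–C §4.2 (rtyu), explicit and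
uniform in `μ`): with `Θ = L(32L²N'²((M₂-M₁)/L+1)/(M₁+1) + 6144 T'² L⁴ N'³ F C/(M₁+1)²)`,
`F = 1 + 64π|k|/(b(M₁+1)N')`, `C = 9 + T'L(8N')^{1/2}(1+log(8L²N'))`,

  `‖𝒮(bμ, N'/μ, γ_μ, 𝓛_μ)‖ ≤ ‖γ_μ‖² (T'L(M₁+1)/2 + (L b Θ)^{1/2})`.

[cite: BettinChandee2018, §4.2] -/
theorem kfO_mu_le (k : ℤ) {b : ℕ} (hb : 0 < b) (γ : ℕ → ℂ) {N' : ℝ} (hN' : 1 / 2 ≤ N')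
    (hγ : ∀ n, γ n ≠ 0 → N' < n ∧ n.Coprime b ∧ Int.gcd k n = 1 ∧ Squarefree n)
    {L : ℕ} (hL : 2 ≤ L) (𝓛 : Finset ℕ)
    (h𝓛 : ∀ ℓ ∈ 𝓛, ℓ.Prime ∧ L < ℓ ∧ ℓ ≤ 2 * L ∧ ℓ.Coprime b ∧ Int.gcd k ℓ = 1)
    {M₁ M₂ : ℕ} (hM : M₁ ≤ M₂) {T' : ℝ}
    (hT' : ∀ w : ℕ, 1 ≤ w → (w : ℝ) ≤ 16 * (L : ℝ) ^ 2 *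
      (N' + (⌈4 * (L : ℝ) * N' / ((M₁ : ℝ) + 1)⌉₊ : ℝ)) + 2 * b * N' → (w.divisors.card : ℝ) ≤ T')
    {μ : ℕ} (hμ : μ ∈ Icc 1 ⌊2 * N'⌋₊) :
    ‖∑ m ∈ (Ioc M₁ M₂).filter (fun m => m.Coprime (b * μ)),
        ∑ ℓ₁ ∈ 𝓛.filter (fun ℓ => ℓ.Coprime μ), ∑ h₁ ∈ Icc 1 ⌊2 * (N' / μ)⌋₊,
        ∑ ℓ₂ ∈ 𝓛.filter (fun ℓ => ℓ.Coprime μ), ∑ h₂ ∈ Icc 1 ⌊2 * (N' / μ)⌋₊,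
          (if (ℓ₁ ≠ ℓ₂ ∧ h₁.Coprime h₂ ∧ (h₁ * h₂).Coprime (ℓ₁ * ℓ₂)) then
            (if (ℓ₂ * h₂).Coprime m ∧ ((ℓ₁ * h₁ : ℕ) : ZMod m) = ((ℓ₂ * h₂ : ℕ) : ZMod m) then
              γ (μ * h₁) * kfPhase k (b * μ * h₁) m *
                (starRingEnd ℂ) (γ (μ * h₂) * kfPhase k (b * μ * h₂) m) else 0)
          else 0)‖ ≤
      (∑ h ∈ Icc 1 ⌊2 * (N' / μ)⌋₊, ‖γ (μ * h)‖ ^ 2) *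
        (T' * L * ((M₁ : ℝ) + 1) / 2 +
          Real.sqrt ((L : ℝ) * b * ((L : ℝ) *
            (32 * (L : ℝ) ^ 2 * N' ^ 2 * (((M₂ : ℝ) - M₁) / L + 1) / ((M₁ : ℝ) + 1) +
              6144 * T' ^ 2 * (L : ℝ) ^ 4 * N' ^ 3 *
                (1 + 64 * Real.pi * |(k : ℝ)| / ((b : ℝ) * ((M₁ : ℝ) + 1) * N')) *
                (9 + T' * L * Real.sqrt (8 * N') * (1 + Real.log (8 * (L : ℝ) ^ 2 * N'))) /
                ((M₁ : ℝ) + 1) ^ 2)))) := by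
  -- abbreviations
  set N'' : ℝ := N' / μ with hN''
  set 𝓛'' := 𝓛.filter (fun ℓ => ℓ.Coprime μ) with h𝓛''
  set I'' := Icc 1 ⌊2 * (N' / μ)⌋₊ with hI''
  set G : ℝ := ∑ h ∈ I'', ‖γ (μ * h)‖ ^ 2 with hG
  set Dg : ℝ := ((M₂ : ℝ) - M₁) / L + 1 with hDg
  set Fs : ℝ := 1 + 64 * Real.pi * |(k : ℝ)| / ((b : ℝ) * ((M₁ : ℝ) + 1) * N') with hFs
  set Cs : ℝ := 9 + T' * L * Real.sqrt (8 * N') * (1 + Real.log (8 * (L : ℝ) ^ 2 * N')) with hCs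
  set Θ : ℝ := (L : ℝ) * (32 * (L : ℝ) ^ 2 * N' ^ 2 * Dg / ((M₁ : ℝ) + 1) +
    6144 * T' ^ 2 * (L : ℝ) ^ 4 * N' ^ 3 * Fs * Cs / ((M₁ : ℝ) + 1) ^ 2) with hΘ
  set D₁ : ℕ := ⌈4 * (L : ℝ) * N' / ((M₁ : ℝ) + 1)⌉₊ with hD₁
  set Dμ : ℕ := ⌈4 * (L : ℝ) * N'' / ((M₁ : ℝ) + 1)⌉₊ with hDμ
  set X : ℝ := 16 * (L : ℝ) ^ 2 * (N' + (D₁ : ℝ)) + 2 * b * N' with hX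
  -- basic facts
  have hμI := Finset.mem_Icc.mp hμ
  have hμ0 : 0 < μ := hμI.1
  have hμR : (1 : ℝ) ≤ μ := by exact_mod_cast hμI.1
  have hμR0 : (0 : ℝ) < μ := by linarith
  have hN'0 : 0 < N' := by linarith
  have hμN : (μ : ℝ) ≤ 2 * N' := (Nat.cast_le.mpr hμI.2).trans (Nat.floor_le (by linarith))
  have hL1 : 1 ≤ L := by omega
  have hL0 : (0 : ℝ) < L := by exact_mod_cast (by omega : 0 < L)
  have hL2 : (2 : ℝ) ≤ L := by exact_mod_cast hL
  have hb0 : (0 : ℝ) < b := by exact_mod_cast hb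
  have hbμ : 0 < b * μ := Nat.mul_pos hb hμ0
  have hM0 : (0 : ℝ) < (M₁ : ℝ) + 1 := by positivity
  have hN''half : 1 / 2 ≤ N'' := by
    rw [hN'', le_div_iff₀ hμR0]; linarith
  have hN''0 : 0 < N'' := by linarith
  have hN''le : N'' ≤ N' := by rw [hN'']; exact div_le_self hN'0.le hμR
  have hD₁ge : 4 * (L : ℝ) * N' / ((M₁ : ℝ) + 1) ≤ D₁ := Nat.le_ceil _
  have hDμge : 4 * (L : ℝ) * N'' / ((M₁ : ℝ) + 1) ≤ Dμ := Nat.le_ceil _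
  have hDμD₁ : Dμ ≤ D₁ := by
    refine Nat.ceil_mono ?_
    exact div_le_div_of_nonneg_right (by nlinarith) hM0.le
  have hT'1 : 1 ≤ T' := by
    have h := hT' 1 le_rfl (by
      push_cast
      have : (1 : ℝ) ≤ (L : ℝ) ^ 2 := by nlinarith
      have : (0 : ℝ) ≤ D₁ := Nat.cast_nonneg _
      nlinarith)
    simpa using h
  have hT'0 : 0 ≤ T' := by linarith
  have hcardL'' : (𝓛''.card : ℝ) ≤ L := by
    have h1 : 𝓛''.card ≤ 𝓛.card := Finset.card_filter_le _ _
    have h2 : 𝓛.card ≤ (Finset.Ioc L (2 * L)).card :=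
      Finset.card_le_card fun ℓ hℓ => Finset.mem_Ioc.mpr ⟨(h𝓛 ℓ hℓ).2.1, (h𝓛 ℓ hℓ).2.2.1⟩
    rw [Nat.card_Ioc] at h2
    have : 2 * L - L = L := by omega
    rw [this] at h2
    exact_mod_cast h1.trans h2
  have h𝓛''hyp : ∀ ℓ ∈ 𝓛'', ℓ.Prime ∧ L < ℓ ∧ ℓ ≤ 2 * L ∧ ℓ.Coprime (b * μ) ∧ Int.gcd k ℓ = 1 := by
    intro ℓ hℓ
    have hℓ' := Finset.mem_filter.mp hℓ
    obtain ⟨hp, h1, h2, h3, h4⟩ := h𝓛 ℓ hℓ'.1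
    exact ⟨hp, h1, h2, Nat.Coprime.mul_right h3 hℓ'.2, h4⟩
  have hγ'' : ∀ h, γ (μ * h) ≠ 0 → N'' < h ∧ h.Coprime (b * μ) ∧ Int.gcd k h = 1 := by
    intro h hh
    obtain ⟨h1, h2, h3, h4⟩ := hγ (μ * h) hh
    refine ⟨?_, ?_, ?_⟩
    · rw [hN'', div_lt_iff₀ hμR0]
      push_cast at h1
      linarith [mul_comm (μ : ℝ) h]
    · have hb' : h.Coprime b := Nat.Coprime.coprime_mul_left h2
      have hμ' : h.Coprime μ := (Nat.squarefree_mul_iff.mp h4).1.symm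
      exact Nat.Coprime.mul_right hb' hμ'
    · rw [Int.gcd_eq_natAbs, Int.natAbs_natCast] at h3 ⊢
      exact Nat.Coprime.coprime_mul_left_right h3
  have hG0 : 0 ≤ G := Finset.sum_nonneg fun h _ => by positivity
  have hDg0 : 0 ≤ Dg := by
    rw [hDg]
    have : (M₁ : ℝ) ≤ M₂ := by exact_mod_cast hM
    have : 0 ≤ ((M₂ : ℝ) - M₁) / L := div_nonneg (by linarith) hL0.le
    linarith
  have hFs1 : 1 ≤ Fs := by
    rw [hFs]
    have : 0 ≤ 64 * Real.pi * |(k : ℝ)| / ((b : ℝ) * ((M₁ : ℝ) + 1) * N') := by positivity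
    linarith
  have hlog8 : 0 ≤ Real.log (8 * (L : ℝ) ^ 2 * N') := by
    refine Real.log_nonneg ?_; nlinarith
  have hCs9 : 9 ≤ Cs := by
    rw [hCs]
    have : 0 ≤ T' * L * Real.sqrt (8 * N') * (1 + Real.log (8 * (L : ℝ) ^ 2 * N')) := by
      positivity
    linarith
  have hΘ0 : 0 ≤ Θ := by
    rw [hΘ]
    have : 0 ≤ Fs := by linarith
    have : 0 ≤ Cs := by linarith
    positivity
  have hX4 : 4 * (L : ℝ) * N' ≤ X := by
    rw [hX]
    have h1 : (0 : ℝ) ≤ (L : ℝ) * N' * (4 * L - 1) :=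
      mul_nonneg (mul_nonneg hL0.le hN'0.le) (by linarith)
    have h2 : (0 : ℝ) ≤ (L : ℝ) ^ 2 * D₁ := by positivity
    have h3 : (0 : ℝ) ≤ (b : ℝ) * N' := by positivity
    nlinarith
  have hX16 : 16 * (L : ℝ) ^ 2 * (N'' + Dμ) ≤ X := by
    rw [hX]
    have h1 : (Dμ : ℝ) ≤ D₁ := by exact_mod_cast hDμD₁
    have h3 : (0 : ℝ) ≤ (b : ℝ) * N' := by positivity
    nlinarith [sq_nonneg (L : ℝ)]
  have hXb : ((b * μ : ℕ) : ℝ) ≤ X := by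
    rw [hX]; push_cast
    have h1 : (b : ℝ) * μ ≤ 2 * b * N' := by nlinarith
    have h2 : (0 : ℝ) ≤ 16 * (L : ℝ) ^ 2 * (N' + D₁) := by positivity
    linarith
  -- divisor bounds at the three ranges
  have hT'a : ∀ w : ℕ, 1 ≤ w → (w : ℝ) ≤ 4 * L * N'' → (w.divisors.card : ℝ) ≤ T' :=
    fun w hw hw' => hT' w hw (hw'.trans ((by nlinarith : 4 * (L : ℝ) * N'' ≤ 4 * L * N').trans hX4))
  have hT'b : ∀ w : ℕ, 1 ≤ w → (w : ℝ) ≤ 16 * (L : ℝ) ^ 2 * (N'' + Dμ) →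
      (w.divisors.card : ℝ) ≤ T' := fun w hw hw' => hT' w hw (hw'.trans hX16)
  have hτbμ : (((b * μ).divisors.card : ℕ) : ℝ) ≤ T' := hT' (b * μ) hbμ hXb
  have hQ0 : 0 ≤ T' * L * ((M₁ : ℝ) + 1) / 2 := by positivity
  have hsq0 : 0 ≤ Real.sqrt ((L : ℝ) * b * Θ) := Real.sqrt_nonneg _
  -- the two regimes
  by_cases hcase : (M₁ : ℝ) + 1 ≤ 4 * L * N''
  · -- Weil regime: `kft_S_le` at level `μ`
    have hDμ' : 4 * (L : ℝ) * N'' ≤ (Dμ : ℝ) * ((M₁ : ℝ) + 1) := by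
      have := hDμge; rwa [div_le_iff₀ hM0] at this
    have hS := kft_S_le k hbμ (fun h => γ (μ * h)) hN''half hγ'' hL1 𝓛'' h𝓛''hyp hM Dμ hDμ'
      hT'b
    -- the pieces
    have hA₁ : (𝓛''.card : ℝ) *
        (((Finset.range (b * μ)).filter (fun c => c.Coprime (b * μ))).card : ℝ) ≤
        (L : ℝ) * ((b * μ : ℕ) : ℝ) := by
      refine mul_le_mul hcardL'' ?_ (Nat.cast_nonneg _) hL0.le
      have h1 : ((Finset.range (b * μ)).filter (fun c => c.Coprime (b * μ))).card ≤ b * μ :=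
        (Finset.card_filter_le _ _).trans (Finset.card_range _).le
      exact_mod_cast h1
    set Dm : ℝ := 8 * L * N' / ((μ : ℝ) * ((M₁ : ℝ) + 1)) with hDm_def
    have hDm : (Dμ : ℝ) ≤ Dm := by
      have hx1 : 1 ≤ 4 * (L : ℝ) * N'' / ((M₁ : ℝ) + 1) := by rw [le_div_iff₀ hM0]; linarith
      have h1 : (Dμ : ℝ) < 4 * (L : ℝ) * N'' / ((M₁ : ℝ) + 1) + 1 :=
        Nat.ceil_lt_add_one (by positivity)
      have h2 : Dm = 2 * (4 * (L : ℝ) * N'' / ((M₁ : ℝ) + 1)) := by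
        rw [hDm_def, hN'']; field_simp; norm_num
      rw [h2]; linarith
    have hDm0 : 0 ≤ Dm := by rw [hDm_def]; positivity
    have hDμμ : (Dμ : ℝ) * μ * ((M₁ : ℝ) + 1) ≤ 8 * L * N' := by
      have := hDm
      rw [hDm_def, le_div_iff₀ (by positivity)] at this
      linarith
    have hFμ : 1 + 8 * Real.pi * |(k : ℝ)| * Dμ / (((b * μ : ℕ) : ℝ) * L * N'' ^ 2) ≤ Fs := by
      rw [hFs]
      have hden : ((b * μ : ℕ) : ℝ) * L * N'' ^ 2 = (b : ℝ) * L * N' ^ 2 / μ := by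
        push_cast; rw [hN'']; field_simp
      rw [hden, div_div_eq_mul_div]
      have hk0 : 0 ≤ 8 * Real.pi * |(k : ℝ)| * (b : ℝ) * N' := by positivity
      have h1 : 8 * Real.pi * |(k : ℝ)| * Dμ * μ / ((b : ℝ) * L * N' ^ 2) ≤
          64 * Real.pi * |(k : ℝ)| / ((b : ℝ) * ((M₁ : ℝ) + 1) * N') := by
        rw [div_le_div_iff₀ (by positivity) (by positivity)]
        nlinarith [mul_le_mul_of_nonneg_left hDμμ hk0]
      linarith
    have hC₁μ0 : 0 ≤ (N'' + 4) / N'' + T' * L * Real.sqrt (8 * N'') *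
        (1 + Real.log (8 * (L : ℝ) ^ 2 * N'')) := by
      have : 0 ≤ Real.log (8 * (L : ℝ) ^ 2 * N'') := Real.log_nonneg (by nlinarith)
      positivity
    have hC₁μ : (N'' + 4) / N'' + T' * L * Real.sqrt (8 * N'') *
        (1 + Real.log (8 * (L : ℝ) ^ 2 * N'')) ≤ Cs := by
      rw [hCs]
      have h1 : (N'' + 4) / N'' ≤ 9 := by rw [div_le_iff₀ hN''0]; linarith
      have hlog'' : 0 ≤ Real.log (8 * (L : ℝ) ^ 2 * N'') := Real.log_nonneg (by nlinarith)
      have h2 : T' * L * Real.sqrt (8 * N'') * (1 + Real.log (8 * (L : ℝ) ^ 2 * N'')) ≤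
          T' * L * Real.sqrt (8 * N') * (1 + Real.log (8 * (L : ℝ) ^ 2 * N')) := by
        refine mul_le_mul (mul_le_mul_of_nonneg_left (Real.sqrt_le_sqrt (by linarith))
          (by positivity)) ?_ (by linarith) (by positivity)
        exact add_le_add le_rfl (Real.log_le_log (by positivity) (by nlinarith))
      linarith
    have hfl : (⌊2 * N''⌋₊ : ℝ) ≤ 2 * N' / μ :=
      (Nat.floor_le (by linarith)).trans (le_of_eq (by rw [hN'']; ring))
    -- `Tb ≤ Θ / μ²`
    have hFμ0 : 0 ≤ 1 + 8 * Real.pi * |(k : ℝ)| * Dμ / (((b * μ : ℕ) : ℝ) * L * N'' ^ 2) := by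
      positivity
    have hFs0 : 0 ≤ Fs := by linarith
    have hCs0 : 0 ≤ Cs := by linarith
    have hTb : (𝓛''.card : ℝ) * ((⌊2 * N''⌋₊ : ℝ) * ((𝓛''.card : ℝ) * (2 * Dμ)) * Dg +
        24 * (((b * μ).divisors.card : ℕ) : ℝ) * (L : ℝ) ^ 2 * (Dμ : ℝ) ^ 2 *
          (4 * T' * N'' * (1 + 8 * Real.pi * |(k : ℝ)| * Dμ / (((b * μ : ℕ) : ℝ) * L * N'' ^ 2)) *
            ((N'' + 4) / N'' + T' * L * Real.sqrt (8 * N'') *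
              (1 + Real.log (8 * (L : ℝ) ^ 2 * N''))))) ≤ Θ / (μ : ℝ) ^ 2 := by
      rw [hΘ]
      exact kfO_alg hL0 hN'0 hμR hM0 hT'0 hDg0 hFs0 hC₁μ0 (Nat.cast_nonneg _)
        (Nat.cast_nonneg _) (Nat.cast_nonneg _) (Nat.cast_nonneg _) hFμ0 hN''0.le hcardL'' hfl
        hDm hτbμ hFμ hC₁μ hN''
    -- combine
    have hsq : Real.sqrt ((𝓛''.card : ℝ) *
        (((Finset.range (b * μ)).filter (fun c => c.Coprime (b * μ))).card : ℝ)) *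
        Real.sqrt ((𝓛''.card : ℝ) * ((⌊2 * N''⌋₊ : ℝ) * ((𝓛''.card : ℝ) * (2 * Dμ)) * Dg +
        24 * (((b * μ).divisors.card : ℕ) : ℝ) * (L : ℝ) ^ 2 * (Dμ : ℝ) ^ 2 *
          (4 * T' * N'' * (1 + 8 * Real.pi * |(k : ℝ)| * Dμ / (((b * μ : ℕ) : ℝ) * L * N'' ^ 2)) *
            ((N'' + 4) / N'' + T' * L * Real.sqrt (8 * N'') *
              (1 + Real.log (8 * (L : ℝ) ^ 2 * N'')))))) ≤ Real.sqrt ((L : ℝ) * b * Θ) := by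
      calc _ ≤ Real.sqrt ((L : ℝ) * ((b * μ : ℕ) : ℝ)) * Real.sqrt (Θ / (μ : ℝ) ^ 2) :=
            mul_le_mul (Real.sqrt_le_sqrt hA₁) (Real.sqrt_le_sqrt hTb) (Real.sqrt_nonneg _)
              (Real.sqrt_nonneg _)
        _ = Real.sqrt ((L : ℝ) * ((b * μ : ℕ) : ℝ) * (Θ / (μ : ℝ) ^ 2)) :=
            (Real.sqrt_mul (by positivity) _).symm
        _ = Real.sqrt ((L : ℝ) * b * Θ / μ) := by
            congr 1; push_cast; field_simp
        _ ≤ Real.sqrt ((L : ℝ) * b * Θ) :=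
            Real.sqrt_le_sqrt (div_le_self (by positivity) hμR)
    calc _ ≤ G * Real.sqrt ((𝓛''.card : ℝ) *
          (((Finset.range (b * μ)).filter (fun c => c.Coprime (b * μ))).card : ℝ)) *
          Real.sqrt ((𝓛''.card : ℝ) * ((⌊2 * N''⌋₊ : ℝ) * ((𝓛''.card : ℝ) * (2 * Dμ)) * Dg +
          24 * (((b * μ).divisors.card : ℕ) : ℝ) * (L : ℝ) ^ 2 * (Dμ : ℝ) ^ 2 *
            (4 * T' * N'' * (1 + 8 * Real.pi * |(k : ℝ)| * Dμ / (((b * μ : ℕ) : ℝ) * L * N'' ^ 2)) *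
              ((N'' + 4) / N'' + T' * L * Real.sqrt (8 * N'') *
                (1 + Real.log (8 * (L : ℝ) ^ 2 * N'')))))) := hS
      _ = G * (Real.sqrt ((𝓛''.card : ℝ) *
          (((Finset.range (b * μ)).filter (fun c => c.Coprime (b * μ))).card : ℝ)) *
          Real.sqrt ((𝓛''.card : ℝ) * ((⌊2 * N''⌋₊ : ℝ) * ((𝓛''.card : ℝ) * (2 * Dμ)) * Dg +
          24 * (((b * μ).divisors.card : ℕ) : ℝ) * (L : ℝ) ^ 2 * (Dμ : ℝ) ^ 2 *
            (4 * T' * N'' * (1 + 8 * Real.pi * |(k : ℝ)| * Dμ / (((b * μ : ℕ) : ℝ) * L * N'' ^ 2)) *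
              ((N'' + 4) / N'' + T' * L * Real.sqrt (8 * N'') *
                (1 + Real.log (8 * (L : ℝ) ^ 2 * N''))))))) := by ring
      _ ≤ G * Real.sqrt ((L : ℝ) * b * Θ) := mul_le_mul_of_nonneg_left hsq hG0
      _ ≤ G * (T' * L * ((M₁ : ℝ) + 1) / 2 + Real.sqrt ((L : ℝ) * b * Θ)) :=
          mul_le_mul_of_nonneg_left (by linarith) hG0
  · -- trivial regime
    push Not at hcase
    have hS := kfm_S_triv k (b * μ) 𝓛''
      (fun ℓ hℓ => ⟨(h𝓛''hyp ℓ hℓ).1, (h𝓛''hyp ℓ hℓ).2.1, (h𝓛''hyp ℓ hℓ).2.2.1⟩) hN''0.le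
      (fun h => γ (μ * h)) hT'0 hT'a ((Ioc M₁ M₂).filter (fun m => m.Coprime (b * μ)))
    have h1 : T' * (𝓛''.card : ℝ) ^ 2 * (2 * N'') ≤ T' * L * ((M₁ : ℝ) + 1) / 2 := by
      have hc2 : (𝓛''.card : ℝ) ^ 2 ≤ (L : ℝ) ^ 2 :=
        pow_le_pow_left₀ (Nat.cast_nonneg _) hcardL'' 2
      have h2 : 2 * N'' ≤ ((M₁ : ℝ) + 1) / (2 * L) := by
        rw [le_div_iff₀ (by positivity)]; linarith
      calc T' * (𝓛''.card : ℝ) ^ 2 * (2 * N'') ≤ T' * (L : ℝ) ^ 2 * (((M₁ : ℝ) + 1) / (2 * L)) :=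
            mul_le_mul (mul_le_mul_of_nonneg_left hc2 hT'0) h2 (by positivity) (by positivity)
        _ = T' * L * ((M₁ : ℝ) + 1) / 2 := by field_simp
    calc _ ≤ T' * (𝓛''.card : ℝ) ^ 2 * ((2 * N'') * G) := hS
      _ = G * (T' * (𝓛''.card : ℝ) ^ 2 * (2 * N'')) := by ring
      _ ≤ G * (T' * L * ((M₁ : ℝ) + 1) / 2) := mul_le_mul_of_nonneg_left h1 hG0
      _ ≤ G * (T' * L * ((M₁ : ℝ) + 1) / 2 + Real.sqrt ((L : ℝ) * b * Θ)) :=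
          mul_le_mul_of_nonneg_left (by linarith) hG0

/-! ### The off-diagonal -/

/-- **The off-diagonal `𝒪_b`** (B–C §4.3 (gyui) with `A = 1`, explicit constants): with
`𝓜 = (M₁,M₂] ∩ {(m,b)=1}`, `γ` supported on square-free `N' < n ≤ 2N'` coprime to `bk` with
`τ(n) ≤ T'`, `𝓛` primes in `(L,2L]` coprime to `bk` (`L ≥ 2`), `T'` a bound for `τ(w)`,
`1 ≤ w ≤ 16L²(N' + ⌈4LN'/(M₁+1)⌉) + 2bN'`, and `Θ, F, C` as in `kfO_mu_le`,

  `‖Σ_{m∈𝓜} kfOff(m)‖ ≤ ‖γ‖² T' ( #𝓛 · 2N'(1 + 4 log(2N')/log L) + T'L(M₁+1)/2 + (L b Θ)^{1/2} )`.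

[cite: BettinChandee2018, §4.3] -/
theorem kfO_le (k : ℤ) {b : ℕ} (hb : 0 < b) (γ : ℕ → ℂ) {N' : ℝ} (hN' : 1 / 2 ≤ N')
    (hγ : ∀ n, γ n ≠ 0 → N' < n ∧ n.Coprime b ∧ Int.gcd k n = 1 ∧ Squarefree n)
    {L : ℕ} (hL : 2 ≤ L) (𝓛 : Finset ℕ)
    (h𝓛 : ∀ ℓ ∈ 𝓛, ℓ.Prime ∧ L < ℓ ∧ ℓ ≤ 2 * L ∧ ℓ.Coprime b ∧ Int.gcd k ℓ = 1)
    {M₁ M₂ : ℕ} (hM : M₁ ≤ M₂) {T' : ℝ} (hγτ : ∀ n, γ n ≠ 0 → (n.divisors.card : ℝ) ≤ T')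
    (hT' : ∀ w : ℕ, 1 ≤ w → (w : ℝ) ≤ 16 * (L : ℝ) ^ 2 *
      (N' + (⌈4 * (L : ℝ) * N' / ((M₁ : ℝ) + 1)⌉₊ : ℝ)) + 2 * b * N' → (w.divisors.card : ℝ) ≤ T') :
    ‖∑ m ∈ (Ioc M₁ M₂).filter (fun m => m.Coprime b), kfOff k b N' γ 𝓛 m‖ ≤
      (∑ n ∈ Icc 1 ⌊2 * N'⌋₊, ‖γ n‖ ^ 2) * T' *
        ((𝓛.card : ℝ) * (2 * N') * (1 + 4 * (Real.log (2 * N') / Real.log L)) +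
          (T' * L * ((M₁ : ℝ) + 1) / 2 +
            Real.sqrt ((L : ℝ) * b * ((L : ℝ) *
              (32 * (L : ℝ) ^ 2 * N' ^ 2 * (((M₂ : ℝ) - M₁) / L + 1) / ((M₁ : ℝ) + 1) +
                6144 * T' ^ 2 * (L : ℝ) ^ 4 * N' ^ 3 *
                  (1 + 64 * Real.pi * |(k : ℝ)| / ((b : ℝ) * ((M₁ : ℝ) + 1) * N')) *
                  (9 + T' * L * Real.sqrt (8 * N') * (1 + Real.log (8 * (L : ℝ) ^ 2 * N'))) /
                  ((M₁ : ℝ) + 1) ^ 2))))) := by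
  set I := Icc 1 ⌊2 * N'⌋₊ with hI
  set G : ℝ := ∑ n ∈ I, ‖γ n‖ ^ 2 with hG
  set Q : ℝ := T' * L * ((M₁ : ℝ) + 1) / 2 +
    Real.sqrt ((L : ℝ) * b * ((L : ℝ) *
      (32 * (L : ℝ) ^ 2 * N' ^ 2 * (((M₂ : ℝ) - M₁) / L + 1) / ((M₁ : ℝ) + 1) +
        6144 * T' ^ 2 * (L : ℝ) ^ 4 * N' ^ 3 *
          (1 + 64 * Real.pi * |(k : ℝ)| / ((b : ℝ) * ((M₁ : ℝ) + 1) * N')) *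
          (9 + T' * L * Real.sqrt (8 * N') * (1 + Real.log (8 * (L : ℝ) ^ 2 * N'))) /
          ((M₁ : ℝ) + 1) ^ 2))) with hQ
  have hN'0 : 0 < N' := by linarith
  have hL0 : (0 : ℝ) < L := by exact_mod_cast (by omega : 0 < L)
  have hD0 : (0 : ℝ) ≤ (⌈4 * (L : ℝ) * N' / ((M₁ : ℝ) + 1)⌉₊ : ℝ) := Nat.cast_nonneg _
  have hX4 : 4 * (L : ℝ) * N' ≤ 16 * (L : ℝ) ^ 2 *
      (N' + (⌈4 * (L : ℝ) * N' / ((M₁ : ℝ) + 1)⌉₊ : ℝ)) + 2 * b * N' := by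
    have h1 : (0 : ℝ) ≤ (L : ℝ) * N' * (4 * L - 1) :=
      mul_nonneg (mul_nonneg hL0.le hN'0.le) (by
        have : (2 : ℝ) ≤ L := by exact_mod_cast hL
        linarith)
    have h2 : (0 : ℝ) ≤ (L : ℝ) ^ 2 * (⌈4 * (L : ℝ) * N' / ((M₁ : ℝ) + 1)⌉₊ : ℝ) := by
      positivity
    have h3 : (0 : ℝ) ≤ (b : ℝ) * N' := by positivity
    nlinarith
  have hT'deg : ∀ w : ℕ, 1 ≤ w → (w : ℝ) ≤ 4 * L * N' → (w.divisors.card : ℝ) ≤ T' :=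
    fun w hw hw' => hT' w hw (hw'.trans hX4)
  have hT'1 : 1 ≤ T' := by
    have h := hT'deg 1 le_rfl (by
      push_cast
      have : (2 : ℝ) ≤ L := by exact_mod_cast hL
      nlinarith)
    simpa using h
  have hT'0 : 0 ≤ T' := by linarith
  have hG0 : 0 ≤ G := Finset.sum_nonneg fun n _ => by positivity
  have hQ0 : 0 ≤ Q := by rw [hQ]; positivity
  have he : ∀ (k : ℤ) (q m : ℕ), kfPhase k q m = Complex.exp (2 * Real.pi * Complex.I *
      ((k : ℂ) * ((((m : ZMod q)⁻¹).val : ℕ) : ℂ) / (q : ℂ))) := fun _ _ _ => rfl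
  rw [kfm_offdiag_split k b N' γ 𝓛 (fun ℓ hℓ => (h𝓛 ℓ hℓ).1) M₁ M₂]
  refine (norm_add_le _ _).trans ?_
  -- the degenerate part
  have hdeg := kfo_deg_bound kfPhase he k b hL 𝓛
    (fun ℓ hℓ => ⟨(h𝓛 ℓ hℓ).1, (h𝓛 ℓ hℓ).2.1, (h𝓛 ℓ hℓ).2.2.1⟩) hN' γ hT'deg
    ((Ioc M₁ M₂).filter (fun m => m.Coprime b))
  -- the `μ`-sum
  have hmu : ∀ μ ∈ I, ‖∑ m ∈ (Ioc M₁ M₂).filter (fun m => m.Coprime (b * μ)),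
      ∑ ℓ₁ ∈ 𝓛.filter (fun ℓ => ℓ.Coprime μ), ∑ h₁ ∈ Icc 1 ⌊2 * (N' / μ)⌋₊,
      ∑ ℓ₂ ∈ 𝓛.filter (fun ℓ => ℓ.Coprime μ), ∑ h₂ ∈ Icc 1 ⌊2 * (N' / μ)⌋₊,
        (if (ℓ₁ ≠ ℓ₂ ∧ h₁.Coprime h₂ ∧ (h₁ * h₂).Coprime (ℓ₁ * ℓ₂)) then
          (if (ℓ₂ * h₂).Coprime m ∧ ((ℓ₁ * h₁ : ℕ) : ZMod m) = ((ℓ₂ * h₂ : ℕ) : ZMod m) then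
            γ (μ * h₁) * kfPhase k (b * μ * h₁) m *
              (starRingEnd ℂ) (γ (μ * h₂) * kfPhase k (b * μ * h₂) m) else 0)
        else 0)‖ ≤ (∑ h ∈ Icc 1 ⌊2 * (N' / μ)⌋₊, ‖γ (μ * h)‖ ^ 2) * Q :=
    fun μ hμ => kfO_mu_le k hb γ hN' hγ hL 𝓛 h𝓛 hM hT' hμ
  have hsumμ := kfm_sum_norm_sq_mu N' γ hγτ
  have hmu' : ‖∑ μ ∈ I, ∑ m ∈ (Ioc M₁ M₂).filter (fun m => m.Coprime (b * μ)),
      ∑ ℓ₁ ∈ 𝓛.filter (fun ℓ => ℓ.Coprime μ), ∑ h₁ ∈ Icc 1 ⌊2 * (N' / μ)⌋₊,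
      ∑ ℓ₂ ∈ 𝓛.filter (fun ℓ => ℓ.Coprime μ), ∑ h₂ ∈ Icc 1 ⌊2 * (N' / μ)⌋₊,
        (if (ℓ₁ ≠ ℓ₂ ∧ h₁.Coprime h₂ ∧ (h₁ * h₂).Coprime (ℓ₁ * ℓ₂)) then
          (if (ℓ₂ * h₂).Coprime m ∧ ((ℓ₁ * h₁ : ℕ) : ZMod m) = ((ℓ₂ * h₂ : ℕ) : ZMod m) then
            γ (μ * h₁) * kfPhase k (b * μ * h₁) m *
              (starRingEnd ℂ) (γ (μ * h₂) * kfPhase k (b * μ * h₂) m) else 0)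
        else 0)‖ ≤ T' * G * Q := by
    refine (norm_sum_le _ _).trans ((Finset.sum_le_sum hmu).trans ?_)
    rw [← Finset.sum_mul]
    calc (∑ μ ∈ I, ∑ h ∈ Icc 1 ⌊2 * (N' / μ)⌋₊, ‖γ (μ * h)‖ ^ 2) * Q ≤ (T' * G) * Q :=
          mul_le_mul_of_nonneg_right hsumμ hQ0
      _ = T' * G * Q := by ring
  calc _ ≤ T' * 𝓛.card * ((2 * N') * G) * (1 + 4 * (Real.log (2 * N') / Real.log L)) +
        T' * G * Q := add_le_add hdeg hmu'
    _ = G * T' * ((𝓛.card : ℝ) * (2 * N') * (1 + 4 * (Real.log (2 * N') / Real.log L)) + Q) := by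
        ring

end Literature.NumberTheory.LFunctions

end
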